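import Literature.NumberTheory.NumberFields.TotallyRealOrCM
import Literature.NumberTheory.GaloisRepresentations.SGeneralQuadraticFamily
import Literature.NumberTheory.Automorphic.HarrisLanTaylorThorneCor627
import HarnessLib

/-!
# The members `K(√-D)` of the patching family are CM fields containing an imaginary
# quadratic field in which `p` splits

Topic `Literature/NumberTheory/Automorphic`.  Glue for the printed proof of Harris–Lan–Taylor–
Thorne's Cor. 7.14 = Thm. A (`HarrisLanTaylorThorne2016.theoremA_existence`, Res. Math. Sci.
3:37 (2016), p. 232: "This can be deduced from Theorem 7.13 by using lemma 1 of [54]. (This is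
the same argument used in the proof of theorem VII.1.9 of [29].)"): Thm. 7.13 is applied to the
base changes of `π` to the fields `F_A = E·A`, `A` an imaginary quadratic field in which `p`
splits, and these fields must satisfy the standing hypotheses of Thm. 7.13 / Cor. 6.27 (p. 11:
"`F⁺` totally real, `F₀` imaginary quadratic, `F = F₀F⁺`, `p` splits in `F₀`" — in the tree:
`IsCMField F` and `NumberField.HasSplitImaginaryQuadraticSubfield F p`,
`HarrisLanTaylorThorneCor627`).  The family itself — `K(√-D)` (`QuadraticFamily.sqrtNegField K D`),
`D` prime with `m ∣ D + 1` — and its `∅`-generality (Sorensen's patching hypothesis) are in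
`GaloisRepresentations/SGeneralQuadraticFamily`; this file proves, for every member:

* `isTotallyComplex_of_sq_eq_neg`, `isTotallyComplex_sqrtNegField` — a field containing `√-D`,
  `D > 0`, has no real place;
* `isCMField_of_forall_isConj` — a totally complex number field with an automorphism inducing
  complex conjugation in **every** complex embedding is CM (corollary of the tree's
  `NumberFields.isTotallyReal_or_isCMField_of_forall_isConj`, `NumberFields/TotallyRealOrCM`);
* `conjRingEquiv`, `conjAlgEquiv`, `isConj_conjAlgEquiv` — the conjugation
  `a + b√-D ↦ c(a) - c(b)√-D` of `K(√-D)` attached to a conjugation `c` of `K`;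
* `isCMField_sqrtNegField` — **`K(√-D)` is a CM field for `K` totally real or CM** (`D > 0`);
* `exists_heightOneSpectrum_natCast_mem` — a place above a given rational prime;
* `hasSplitImaginaryQuadraticSubfield_sqrtNegField` — **`K(√-D)` contains the imaginary
  quadratic field `ℚ(√-D)`, in which `p` splits when `8p ∣ D + 1`** (decomposition law over `ℚ`,
  through `QuadraticFamily.isSquare_adicCompletion_neg_natCast` and
  `QuadraticExtension.ncard_finitePlacesOver_eq_two_of_isSquare`);
* `QuadraticFamily.GoodPrime.isCMField`, `QuadraticFamily.GoodPrime.hasSplitImaginaryQuadraticSubfield`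
  — the same for the indexed family `GoodPrime K (8 * p) X` (deliberate dot-notation extensions
  of the structure of `SGeneralQuadraticFamily`, declared by absolute name).

Everything is proved; no named facts.  Not here: the base change of `π` to `K(√-D)` and the
assembly of Cor. 7.14 (which need Thm. 7.13 for every member and quadratic base change at every
place).

## References

* M. Harris, K.-W. Lan, R. Taylor, J. Thorne, *On the rigid cohomology of certain Shimura
  varieties*, Res. Math. Sci. 3:37 (2016): p. 11 (standing hypotheses), proof of Cor. 7.14
  (p. 232). [HarrisLanTaylorThorneRMS2016]
* M. Harris, R. Taylor, *The geometry and cohomology of some simple Shimura varieties*, Ann. of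
  Math. Stud. 151 (2001), proof of Thm. VII.1.9 (pp. 229–232: the fields `F_A = LA`, "`l` and
  `x|_ℚ` split in `A`"). [HarrisTaylorAMS2001]
* C. M. Sorensen, *A patching lemma*, in: Shimura Varieties, LMS Lecture Note Ser. 457 (2020),
  § 1, Example ("a similar family of CM extensions of any given totally real field `F`, by
  taking … the composite fields `F𝓘`"). [Sorensen2020]
-/

noncomputable section

open scoped NumberField Polynomial IntermediateField ComplexConjugate
open Field IsDedekindDomain NumberField Polynomial
open Literature.NumberTheory.GaloisRepresentations
open Literature.NumberTheory.GaloisRepresentations.QuadraticFamily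

namespace Literature.NumberTheory.Automorphic

namespace PatchingFamily

/-! ### No real places -/

/-- A field containing a square root of `-D`, `D > 0`, is totally complex: a real embedding `ψ`
would give `ψ(x)² = -D < 0`. [folklore] -/
theorem isTotallyComplex_of_sq_eq_neg {L : Type*} [Field L] {D : ℕ} (hD : D ≠ 0) {x : L}
    (hx : x ^ 2 = -(D : L)) : IsTotallyComplex L := by
  refine ⟨fun w ↦ ?_⟩
  rw [← InfinitePlace.not_isReal_iff_isComplex]
  rintro ⟨φ, hφ, -⟩
  set ψ := hφ.embedding
  have h : (ψ x) ^ 2 = -(D : ℝ) := by rw [← map_pow, hx, map_neg, map_natCast]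
  have hD' : (0 : ℝ) < D := by exact_mod_cast Nat.pos_of_ne_zero hD
  nlinarith [sq_nonneg (ψ x)]

variable {K : Type*} [Field K] {D : ℕ}

/-- `K(√-D)` is totally complex (`D > 0`). [folklore] -/
theorem isTotallyComplex_sqrtNegField [Fact (¬ IsSquare (-(D : K)))] (hD : D ≠ 0) :
    IsTotallyComplex (sqrtNegField K D) :=
  isTotallyComplex_of_sq_eq_neg hD (x := QuadraticAlgebra.omega) (by rw [omega_sq, map_neg, map_natCast])

/-! ### A CM criterion: one automorphism inducing complex conjugation everywhere -/

/-- **A totally complex number field with a "complex conjugation" is CM**: if `σ ∈ Aut(L)`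
satisfies `φ ∘ σ = conj ∘ φ` for *every* embedding `φ : L → ℂ`, then `L` is a CM field.  A
three-line corollary of the tree's
`Literature.NumberTheory.NumberFields.isTotallyReal_or_isCMField_of_forall_isConj`
(`NumberFields/TotallyRealOrCM`: such an `L` is totally real or CM — Mathlib's
`IsCMField.of_forall_isConj` without its hypothesis `IsGalois ℚ L`), the totally real branch
being absurd for a totally complex `L` (`IsTotallyComplex.complexEmbedding_not_isReal`).
[folklore] -/
theorem isCMField_of_forall_isConj {L : Type*} [Field L] [NumberField L] [IsTotallyComplex L]
    (σ : L ≃ₐ[ℚ] L) (hσ : ∀ φ : L →+* ℂ, ComplexEmbedding.IsConj φ σ) : IsCMField L := by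
  refine (NumberFields.isTotallyReal_or_isCMField_of_forall_isConj σ hσ).resolve_left fun h ↦ ?_
  obtain ⟨φ⟩ := (inferInstance : Nonempty (L →+* ℂ))
  exact IsTotallyComplex.complexEmbedding_not_isReal φ (IsTotallyReal.complexEmbedding_isReal φ)

/-! ### The conjugation of `K(√-D)` -/

section Conj

variable [Fact (¬ IsSquare (-(D : K)))]

/-- **The conjugation `a + b√-D ↦ c(a) - c(b)√-D`** of `K(√-D)` attached to a ring automorphism
`c` of `K` (`c(D) = D` automatically): a ring automorphism (direct check on
`QuadraticAlgebra K (-D) 0`). [folklore] -/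
def conjRingEquiv (c : K ≃+* K) : sqrtNegField K D ≃+* sqrtNegField K D where
  toFun x := ⟨c x.re, -(c x.im)⟩
  invFun x := ⟨c.symm x.re, -(c.symm x.im)⟩
  left_inv x := by ext <;> simp
  right_inv x := by ext <;> simp
  map_mul' x y := by
    ext
    · simp only [QuadraticAlgebra.re_mul, map_add, map_mul, map_neg, map_natCast]
      ring
    · simp only [QuadraticAlgebra.im_mul, map_add, map_mul, zero_mul, add_zero]
      ring
  map_add' x y := by
    ext
    · simp only [QuadraticAlgebra.re_add, map_add]
    · simp only [QuadraticAlgebra.im_add, map_add, neg_add]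

omit [Fact (¬ IsSquare (-(D : K)))] in
/-- `conjRingEquiv c ⟨a, b⟩ = ⟨c a, -c b⟩` (real part). [folklore] -/
@[simp] theorem conjRingEquiv_apply_re (c : K ≃+* K) (x : sqrtNegField K D) :
    (conjRingEquiv c x).re = c x.re := rfl

omit [Fact (¬ IsSquare (-(D : K)))] in
/-- `conjRingEquiv c ⟨a, b⟩ = ⟨c a, -c b⟩` (imaginary part). [folklore] -/
@[simp] theorem conjRingEquiv_apply_im (c : K ≃+* K) (x : sqrtNegField K D) :
    (conjRingEquiv c x).im = -(c x.im) := rfl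

variable [CharZero K]

/-- The conjugation as a `ℚ`-algebra automorphism of `K(√-D)` (it fixes `ℚ`, `map_ratCast`).
[folklore] -/
def conjAlgEquiv (c : K ≃+* K) : sqrtNegField K D ≃ₐ[ℚ] sqrtNegField K D :=
  AlgEquiv.ofRingEquiv (f := conjRingEquiv c) fun q ↦ by
    rw [eq_ratCast]
    exact map_ratCast _ q

/-- `conjAlgEquiv c x = conjRingEquiv c x`. [folklore] -/
@[simp] theorem conjAlgEquiv_apply (c : K ≃+* K) (x : sqrtNegField K D) :
    conjAlgEquiv c x = conjRingEquiv c x := rfl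

/-- A complex number with `z² = -D`, `D > 0`, is purely imaginary: `conj z = -z`
(`|z|² = D = -z²`). [folklore] -/
theorem conj_eq_neg_of_mul_self_eq_neg {z : ℂ} (hD : D ≠ 0) (hz : z * z = -(D : ℂ)) :
    conj z = -z := by
  have hn : Complex.normSq z = D := by
    have h := congrArg Complex.normSq hz
    rw [Complex.normSq_mul, Complex.normSq_neg, Complex.normSq_natCast] at h
    exact (mul_self_inj (Complex.normSq_nonneg z) (Nat.cast_nonneg D)).mp h
  have hcz : conj z * z = (D : ℂ) := by
    rw [← Complex.normSq_eq_conj_mul_self, hn, Complex.ofReal_natCast]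
  have hz0 : z ≠ 0 := by
    rintro rfl
    rw [zero_mul, eq_comm, neg_eq_zero, Nat.cast_eq_zero] at hz
    exact hD hz
  have h0 : (conj z + z) * z = 0 := by linear_combination hcz + hz
  rcases mul_eq_zero.mp h0 with h | h
  · linear_combination h
  · exact absurd h hz0

/-- **`conjAlgEquiv c` induces complex conjugation in every embedding** `φ : K(√-D) → ℂ`,
provided `c` does so in every embedding of `K` (`φ(ω)` is purely imaginary as `φ(ω)² = -D < 0`,
so `conj(φ(a) + φ(b)φ(ω)) = φ(c a) - φ(c b)φ(ω)`). [folklore] -/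
theorem isConj_conjAlgEquiv (hD : D ≠ 0) (c : K ≃+* K)
    (hc : ∀ (φ₀ : K →+* ℂ) (a : K), conj (φ₀ a) = φ₀ (c a)) (φ : sqrtNegField K D →+* ℂ) :
    ComplexEmbedding.IsConj φ (conjAlgEquiv c) := by
  set z : ℂ := φ QuadraticAlgebra.omega with hzdef
  have hz : z * z = -(D : ℂ) := by
    rw [hzdef, ← map_mul, ← sq, omega_sq, map_neg, map_natCast, map_neg, map_natCast]
  have hconj : conj z = -z := conj_eq_neg_of_mul_self_eq_neg hD hz
  set φ₀ : K →+* ℂ := φ.comp (algebraMap K (sqrtNegField K D)) with hφ₀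
  have hdec : ∀ x : sqrtNegField K D,
      φ x = φ₀ x.re + φ₀ x.im * z := fun x ↦ by
    conv_lhs => rw [← QuadraticAlgebra.mk_eta x, QuadraticAlgebra.mk_eq_add_smul_omega,
      Algebra.smul_def]
    rw [map_add, map_mul]
    rfl
  unfold ComplexEmbedding.IsConj
  ext1 x
  rw [ComplexEmbedding.conjugate_coe_eq, RingHom.coe_comp, Function.comp_apply, hdec x, map_add,
    map_mul, hc, hc, hconj]
  change _ = φ (conjAlgEquiv c x)
  rw [hdec (conjAlgEquiv c x), conjAlgEquiv_apply, conjRingEquiv_apply_re, conjRingEquiv_apply_im,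
    map_neg]
  ring

end Conj

/-! ### `K(√-D)` is CM for `K` totally real or CM -/

/-- **`K(√-D)` (`D > 0`) is a CM field whenever `K` is totally real or CM** — the members
`F_A = E·A` of Harris–Taylor's and Harris–Lan–Taylor–Thorne's families are CM fields (HLTT p. 11:
"`F = F₀F⁺`").  Proof: `K` carries a conjugation `c` inducing complex conjugation in every
embedding (the identity if `K` is totally real; Mathlib's `NumberField.complexConj K` if `K` is
CM, `isConj_complexConj`), the conjugation `a + b√-D ↦ c(a) - c(b)√-D` of `K(√-D)` then does the
same (`isConj_conjAlgEquiv`), and `isCMField_of_forall_isConj` applies (`K(√-D)` is totally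
complex, `isTotallyComplex_sqrtNegField`).
[cite: HarrisLanTaylorThorneRMS2016, §1 (p. 11) and proof of Cor. 7.14 (p. 232)] -/
theorem isCMField_sqrtNegField [NumberField K] [Fact (¬ IsSquare (-(D : K)))]
    (hK : IsTotallyReal K ∨ IsCMField K) (hD : D ≠ 0) : IsCMField (sqrtNegField K D) := by
  haveI := isTotallyComplex_sqrtNegField (K := K) (D := D) hD
  obtain ⟨c, hc⟩ : ∃ c : K ≃+* K, ∀ (φ₀ : K →+* ℂ) (a : K), conj (φ₀ a) = φ₀ (c a) := by
    rcases hK with hK | hK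
    · refine ⟨RingEquiv.refl K, fun φ₀ a ↦ ?_⟩
      have h := ComplexEmbedding.isReal_iff.mp (IsTotallyReal.complexEmbedding_isReal φ₀)
      have ha := RingHom.congr_fun h a
      rw [ComplexEmbedding.conjugate_coe_eq] at ha
      rw [ha]
      rfl
    · exact ⟨(IsCMField.complexConj K).toRingEquiv, fun φ₀ a ↦
        ((IsCMField.isConj_complexConj K φ₀).eq a).symm⟩
  exact isCMField_of_forall_isConj (conjAlgEquiv c) (isConj_conjAlgEquiv hD c hc)

/-! ### The imaginary quadratic subfield `ℚ(√-D)` and the splitting of `p` -/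

/-- Every rational prime lies below some finite place of a number field. [folklore] -/
theorem exists_heightOneSpectrum_natCast_mem (F : Type*) [Field F] [NumberField F] {p : ℕ}
    (hp : p.Prime) : ∃ v : HeightOneSpectrum (𝓞 F), ((p : ℕ) : 𝓞 F) ∈ v.asIdeal := by
  have hp' : Prime (p : ℤ) := Nat.prime_iff_prime_int.mp hp
  haveI : (Ideal.span {(p : ℤ)}).IsPrime := (Ideal.span_singleton_prime hp'.ne_zero).mpr hp'
  have hinj : Function.Injective (algebraMap ℤ (𝓞 F)) := (algebraMap ℤ (𝓞 F)).injective_int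
  obtain ⟨Q, -, hQ, hQp⟩ := Ideal.exists_ideal_over_prime_of_isIntegral
    (S := 𝓞 F) (Ideal.span {(p : ℤ)}) ⊥
    (by
      rw [← RingHom.ker_eq_comap_bot, (RingHom.injective_iff_ker_eq_bot _).mp hinj]
      exact bot_le)
  have hmem : (p : ℤ) ∈ Q.comap (algebraMap ℤ (𝓞 F)) := by
    rw [hQp]
    exact Ideal.mem_span_singleton_self _
  refine ⟨⟨Q, hQ, fun hQbot ↦ hp'.ne_zero ?_⟩, ?_⟩
  · rw [hQbot, Ideal.mem_comap, Ideal.mem_bot, map_eq_zero_iff _ hinj] at hmem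
    exact hmem
  · rw [Ideal.mem_comap, map_natCast] at hmem
    exact hmem

/-- **`K(√-D)` contains the imaginary quadratic field `ℚ(√-D)`, in which `p` splits when
`8p ∣ D + 1`** — the standing hypothesis "`F₀ ⊆ F` imaginary quadratic, `p` splits in `F₀`" of
Harris–Lan–Taylor–Thorne (p. 11) for the member `K(√-D)`, in the tree's rendering
`NumberField.HasSplitImaginaryQuadraticSubfield` (`HarrisLanTaylorThorneCor627`).  Here
`F₀ = ℚ(ω)`, `ω = √-D`: `[F₀ : ℚ] = 2` (`minpoly ω = X² + D`, as `ω ∉ ℚ`), `F₀` is totally complex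
(`isTotallyComplex_of_sq_eq_neg`), and the place `p` of `ℚ` has two places of `F₀` above it by
the decomposition law (`QuadraticExtension.ncard_finitePlacesOver_eq_two_of_isSquare`: `-D` is a
square in `ℚ_p` for `-D ≡ 1 (mod 8p)`, `QuadraticFamily.isSquare_adicCompletion_neg_natCast`),
i.e. two primes of `𝓞_{F₀}` containing `p`.
[cite: HarrisLanTaylorThorneRMS2016, §1 (p. 11)] [cite: Sorensen2020, §1 Example] -/
theorem hasSplitImaginaryQuadraticSubfield_sqrtNegField [NumberField K] [Fact (¬ IsSquare (-(D : K)))]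
    {p : ℕ} (hp : p.Prime) (hD0 : D ≠ 0) (hD : 8 * p ∣ D + 1) :
    HasSplitImaginaryQuadraticSubfield (sqrtNegField K D) p := by
  classical
  set ω : sqrtNegField K D := QuadraticAlgebra.omega with hωdef
  have hω : ω ^ 2 = -(D : sqrtNegField K D) := by rw [hωdef, omega_sq, map_neg, map_natCast]
  have hωim : ω.im = 1 := rfl
  -- `F₀ = ℚ(ω)`
  set F₀ : IntermediateField ℚ (sqrtNegField K D) := ℚ⟮ω⟯ with hF₀
  set ω₀ : F₀ := ⟨ω, IntermediateField.mem_adjoin_simple_self ℚ ω⟩ with hω₀def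
  have hω₀ : ω₀ ^ 2 = algebraMap ℚ F₀ (-(D : ℚ)) := by
    apply Subtype.ext
    simp [hω₀def, hω]
  have hω₀' : ω₀ ^ 2 = -(D : F₀) := by rw [hω₀, map_neg, map_natCast]
  have hω₀Q : ∀ r : ℚ, algebraMap ℚ F₀ r ≠ ω₀ := by
    intro r h
    have h' : ((algebraMap ℚ F₀ r : F₀) : sqrtNegField K D).im = ω.im := by rw [h]
    have h0 : ((algebraMap ℚ F₀ r : F₀) : sqrtNegField K D) = (r : sqrtNegField K D) :=
      eq_ratCast ((F₀.val : F₀ →+* sqrtNegField K D).comp (algebraMap ℚ F₀)) r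
    rw [h0, hωim] at h'
    exact zero_ne_one h'
  -- `[F₀ : ℚ] = 2`
  have hint : IsIntegral ℚ ω := by
    refine ⟨X ^ 2 + C (D : ℚ), monic_X_pow_add_C _ two_ne_zero, ?_⟩
    rw [← aeval_def]
    simp [hω]
  have hdeg : (minpoly ℚ ω).natDegree = 2 := by
    apply le_antisymm
    · have h := minpoly.degree_le_of_ne_zero ℚ ω (p := X ^ 2 + C (D : ℚ))
        (monic_X_pow_add_C _ two_ne_zero).ne_zero (by simp [hω])
      rw [degree_X_pow_add_C two_pos] at h
      exact natDegree_le_iff_degree_le.mpr h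
    · rw [minpoly.two_le_natDegree_iff hint]
      rintro ⟨r, hr⟩
      have h' : ((r : sqrtNegField K D)).im = ω.im := by
        rw [← eq_ratCast (algebraMap ℚ (sqrtNegField K D)) r, hr]
      rw [hωim] at h'
      exact zero_ne_one h'
  have hfin : Module.finrank ℚ F₀ = 2 := by rw [hF₀, IntermediateField.adjoin.finrank hint, hdeg]
  haveI : Algebra.IsQuadraticExtension ℚ F₀ := ⟨hfin⟩
  -- `F₀` is totally complex
  have htc : IsTotallyComplex F₀ := isTotallyComplex_of_sq_eq_neg hD0 hω₀'
  -- two places of `F₀` above `p`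
  obtain ⟨v, hv⟩ := exists_heightOneSpectrum_natCast_mem ℚ hp
  have hsq := isSquare_adicCompletion_neg_natCast (K := ℚ) v hp hv hD
  have h2 : (QuadraticForms.finitePlacesOver F₀ v).ncard = 2 :=
    QuadraticForms.QuadraticExtension.ncard_finitePlacesOver_eq_two_of_isSquare (K := ℚ) (E := F₀)
      hω₀ hω₀Q v hsq
  obtain ⟨w, w', hne, hww'⟩ := Set.ncard_eq_two.mp h2
  have hmem : ∀ u ∈ QuadraticForms.finitePlacesOver F₀ v, ((p : ℕ) : 𝓞 F₀) ∈ u.asIdeal := by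
    intro u hu
    rw [QuadraticForms.mem_finitePlacesOver_iff] at hu
    have h : ((p : ℕ) : 𝓞 ℚ) ∈ (u.under (𝓞 ℚ)).asIdeal := by rw [hu]; exact hv
    rw [HeightOneSpectrum.under_asIdeal, Ideal.under_def, Ideal.mem_comap, map_natCast] at h
    exact h
  exact ⟨F₀, ⟨hfin, htc⟩, w, w', hne, hmem w (by rw [hww']; exact Set.mem_insert _ _),
    hmem w' (by rw [hww']; exact Set.mem_insert_of_mem _ (Set.mem_singleton _))⟩

end PatchingFamily

end Literature.NumberTheory.Automorphic

/-! ### The indexed family `GoodPrime K (8p) X` -/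

namespace Literature.NumberTheory.GaloisRepresentations.QuadraticFamily.GoodPrime

open Literature.NumberTheory.Automorphic

variable {K : Type} [Field K] [NumberField K] {m : ℕ} {X : Set ℕ}

omit [NumberField K] in
/-- A good prime is non-zero. [folklore] -/
theorem ne_zero (i : GoodPrime K m X) : i.1 ≠ 0 := i.2.1.ne_zero

/-- **The members of the patching family are CM fields** (`K` totally real or CM).  Deliberate
dot-notation extension of `QuadraticFamily.GoodPrime` (`SGeneralQuadraticFamily`).
[cite: HarrisLanTaylorThorneRMS2016, §1 (p. 11) and proof of Cor. 7.14 (p. 232)] -/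
theorem isCMField (hK : IsTotallyReal K ∨ IsCMField K) (i : GoodPrime K m X) :
    IsCMField (sqrtNegField K i.1) :=
  PatchingFamily.isCMField_sqrtNegField hK i.ne_zero

/-- **The members of the family `GoodPrime K (8p) X` contain an imaginary quadratic field in
which `p` splits** (`ℚ(√-D)`, `-D ≡ 1 (mod 8p)`).  Deliberate dot-notation extension of
`QuadraticFamily.GoodPrime`. [cite: HarrisLanTaylorThorneRMS2016, §1 (p. 11)] -/
theorem hasSplitImaginaryQuadraticSubfield {p : ℕ} (hp : p.Prime) (i : GoodPrime K (8 * p) X) :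
    HasSplitImaginaryQuadraticSubfield (sqrtNegField K i.1) p :=
  PatchingFamily.hasSplitImaginaryQuadraticSubfield_sqrtNegField hp i.ne_zero i.2.2.1

end Literature.NumberTheory.GaloisRepresentations.QuadraticFamily.GoodPrime
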